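import Summits.ResolutionOfSingularities.ResolutionOfSingularities.Theorems.WeightedInvariantHypersurfaceCentreAssemblyExcModel
import HarnessLib

/-!
# Door assembly H2c″, stub [S6] — the EXCEPTIONAL HALF: `ι` drops at the points of the successor over the maximum locus

Route `ResolutionOfSingularities/WeightedInvariant`, crux `Theses.WeightedInvariant.HypersurfaceCentreConstruction`
(stmt-ResolutionOfSingularities-19897), door line `local-engine`, registered stub [S6] `stub_iotaMax_lt_of_step`
(holder res-L1-w43-stub-9 = res-D-brk-1; plan of record `S6-PLAN.md`, EXC half; model computation in
`…CentreAssemblyExcModel`).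

Setting: `ι`, `J` with (c6) `IotaIsoInvariant`, (c12a) `IotaUnitInvariant` / `JUnitInvariant`, `JIsoInvariant` and the
canonical game clause (c9′) `CanonicalGameClause p ι J`; `Y → Spec k` smooth over a perfect field of characteristic
`p`; `X` an ideal sheaf on `Y`, principal on the affine open `U ∋ y`: `X(U) = (F)`; `R` THE canonical centre of `(Y, X)`
(`IsCanonicalCentre ι J X R`) and `R'` a Rees filtration with the pieces of `R`; `y` a point of the MAXIMUM LOCUS.
On the successor side: any scheme `Y'`, ideal sheaf `X'`, point `y' ∈ singImage X'` with regular stalk `𝒪_{Y',y'}` and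
principal `X'_{y'}`, and a MODEL of that stalk as a local ring of the chart `⊕ₙ 𝒥ₙ(U) tⁿ` of the global cobordant
blow-up over `U`: a ring isomorphism `Ψ₁ : 𝒪_{Y',y'} ≃+* (⊕ₙ 𝒥ₙ(U) tⁿ)_𝔫` at a prime `𝔫` lying over the prime of `y`,
off the irrelevant ideal, carrying `X'_{y'}` onto the `t⁻¹`-saturation of `X(U) · (⊕ₙ 𝒥ₙ(U) tⁿ)_𝔫` (the three facts
(I)(II)(III) of the holder's K4-E stalk chain, supplied for `Y' = B₊`, `X' = σˢ(X)|_{B₊}` by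
`…CentreAssemblyPlusStalk`).  CONCLUSION (`iotaAt_lt_iotaMax_of_mem_maxLocus_of_stalkIso`): `iotaAt ι X' y' < iotaMax ι X`,
by `iota_lt_of_plusStalk_model` at the position `(Γ(Y,U)_𝔮, F/1)`, whose `ι` is `iotaAt ι X y = iotaMax ι X`
(`…StalkDict`) and whose canonical filtration is presented by the pieces of `R` (`IsCanonicalCentre`).

Def-free helper (`--supports stmt-ResolutionOfSingularities-19897`); OURS bookkeeping on the candidate clauses of H2a⁗ —
no claim about Hironaka's problem.  AI-written, weaker than expert review.  [cite: Wlodarczyk2022, 3.3.12 and Def. 5.1.1]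
-/

noncomputable section

set_option linter.dupNamespace false -- mandated namespace of this single-conjunct summit

open scoped LaurentPolynomial
open LaurentPolynomial CategoryTheory AlgebraicGeometry TopologicalSpace IsLocalRing
open Literature.AlgebraicGeometry.Resolution
open Summit.ResolutionOfSingularities.ResolutionOfSingularities.Theorems

namespace Summit.ResolutionOfSingularities.ResolutionOfSingularities.Cruxes.HypersurfaceCentreConstruction.LocalEngine

/-! ## The exceptional half of [S6] from a GAME-SIDE model of the successor's stalk (res-type-089's export (A)
`exists_gameSide_stalk_model`: the model is already a local ring of the game-side carrier `A'[t⁻¹, 𝒥ₙ tⁿ]`) -/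

section ExcGameSide

variable {p : ℕ} (ι : (R : Type) → [CommRing R] → R → Ordinal.{0})
  (J : (R : Type) → [CommRing R] → R → ℕ → Ideal R)

/-- Step 3′ — reading `ι` and `𝔪²` through ONE ring isomorphism `Ψ : Sy ≃+* (A'[t⁻¹, 𝒥ₙ tⁿ])_{𝔫'}`: if `gen ∈ 𝔪_{Sy}²`
and `Ψ⁻¹ γ` divide each other in the regular local ring `Sy`, then `ι(Sy, gen) = ι(O', γ)` and `γ ∈ 𝔪_{O'}²`
((c6) instantiated at the concrete rings first, (c12a) for the unit, locality of `Ψ`). [folklore] -/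
theorem iota_eq_and_mem_sq_of_dvd_dvd' (hc6 : IotaIsoInvariant ι) (hu : IotaUnitInvariant ι)
    {A' : Type} [CommRing A'] {I' : ℕ → Ideal A'} (𝔫' : Ideal (extReesAlgebra I')) [𝔫'.IsPrime]
    {Sy : Type} [CommRing Sy] [IsRegularLocalRing Sy] (Ψ : Sy ≃+* Localization.AtPrime 𝔫')
    {gen : Sy} (hgen2 : gen ∈ maximalIdeal Sy ^ 2) (γ : Localization.AtPrime 𝔫')
    (hd1 : gen ∣ Ψ.symm γ) (hd2 : Ψ.symm γ ∣ gen) :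
    ι Sy gen = ι (Localization.AtPrime 𝔫') γ ∧ γ ∈ maximalIdeal (Localization.AtPrime 𝔫') ^ 2 := by
  haveI : IsDomain Sy := isDomain_of_isRegularLocalRing Sy
  obtain ⟨v, hv⟩ := associated_of_dvd_dvd hd1 hd2
  have hgx : Ψ (Ψ.symm γ) = γ := RingEquiv.apply_symm_apply Ψ γ
  constructor
  · have h6 := hc6 Sy (Localization.AtPrime 𝔫')
    have hι1 : ι (Localization.AtPrime 𝔫') (Ψ (Ψ.symm γ)) = ι Sy (Ψ.symm γ) := h6 Ψ _
    have hι2 : ι Sy (Ψ.symm γ) = ι Sy gen := by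
      rw [← hv, mul_comm]
      exact hu Sy (v : Sy) gen v.isUnit
    rw [← hι2, ← hι1, hgx]
  · have hΨm : (maximalIdeal Sy).map (Ψ : Sy →+* Localization.AtPrime 𝔫') ≤
        maximalIdeal (Localization.AtPrime 𝔫') := by
      refine Ideal.map_le_iff_le_comap.mpr fun x hx => ?_
      rw [Ideal.mem_comap]
      rw [IsLocalRing.mem_maximalIdeal, mem_nonunits_iff] at hx ⊢
      intro hux
      apply hx
      have h := hux.map Ψ.symm
      simpa only [RingHom.coe_coe, RingEquiv.symm_apply_apply] using h
    have hx₀ : Ψ.symm γ ∈ maximalIdeal Sy ^ 2 := by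
      rw [← hv]
      exact Ideal.mul_mem_right _ _ hgen2
    have h := Ideal.mem_map_of_mem (Ψ : Sy →+* Localization.AtPrime 𝔫') hx₀
    rw [Ideal.map_pow, RingHom.coe_coe, hgx] at h
    exact Ideal.pow_right_mono hΨm 2 h

/-- **[S6], EXCEPTIONAL HALF — game-side model form.**  As `iota_lt_of_plusStalk_model`, but the successor's regular local
ring `Sy` is modelled DIRECTLY by local rings of the game-side carriers: for every sequence `I'` of ideals of `A'` extended
from the pieces `Pc n ≤ A` there are a prime `𝔫'` of `A'[t⁻¹, I'ₙ tⁿ]` off the vertex and containing `𝔪_{A'}`, and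
`Ψ : Sy ≃+* (A'[t⁻¹, I'ₙ tⁿ])_{𝔫'}` carrying `(gen)` onto the `t⁻¹`-saturation of `K₀` (res-type-089's export (A), which
has the chart-to-game bridge inside).  Then `ι(Sy, gen) < ι(A', f₀)` by the (drop) clause at the prime for
`I' := weightedMonomialIdeal u w` of the canonical move. [cite: Wlodarczyk2022, 3.3.12 and Def. 5.1.1] -/
theorem iota_lt_of_gameSide_model (hc6 : IotaIsoInvariant ι) (hu : IotaUnitInvariant ι)
    (hgame : CanonicalGameClause p ι J) (k : Type) [Field k] [CharP k p] [PerfectField k]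
    {A : Type} [CommRing A] {A' : Type} [CommRing A'] [Algebra A A'] [IsRegularLocalRing A']
    [Algebra k A'] [Algebra.EssFiniteType k A']
    {f₀ : A'} (hf0 : f₀ ≠ 0) (hf2 : f₀ ∈ maximalIdeal A' ^ 2)
    (Pc : ℕ → Ideal A) (hPJ : ∀ m, (Pc m).map (algebraMap A A') = J A' f₀ m)
    (K₀ : Ideal A) (hK₀ : K₀.map (algebraMap A A') = Ideal.span {f₀})
    {Sy : Type} [CommRing Sy] [IsRegularLocalRing Sy] {gen : Sy} (hgen2 : gen ∈ maximalIdeal Sy ^ 2)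
    (Igen : Ideal Sy) (hIgen : Igen = Ideal.span {gen})
    (hmodel : ∀ {I' : ℕ → Ideal A'}, (∀ n, I' n = (Pc n).map (algebraMap A A')) →
      ∃ (𝔫' : Ideal (extReesAlgebra I')) (_ : 𝔫'.IsPrime) (Ψ : Sy ≃+* Localization.AtPrime 𝔫'),
        Igen.map (Ψ : Sy →+* Localization.AtPrime 𝔫') =
          ⨆ n : ℕ, ((((K₀.map (algebraMap A A')).map (algebraMap A' (extReesAlgebra I'))).map
            (algebraMap (extReesAlgebra I') (Localization.AtPrime 𝔫'))).colon
            {algebraMap (extReesAlgebra I') (Localization.AtPrime 𝔫') (extReesAlgebra.tInv I') ^ n}) ∧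
        ¬ extReesAlgebra.vertexIdeal I' ≤ 𝔫' ∧ (maximalIdeal A').map (algebraMap A' (extReesAlgebra I')) ≤ 𝔫') :
    ι Sy gen < ι A' f₀ := by
  subst hIgen
  -- the canonical game at the position `(A', f₀)`
  obtain ⟨P, hP, -, -, -, -, n, u, w, hspan, hrk, -, -, hpres, -, hdrop⟩ := hgame k A' f₀ hf0 hf2
  haveI := hP
  have hI' : ∀ m, weightedMonomialIdeal u w m = (Pc m).map (algebraMap A A') :=
    fun m => (hpres m).trans (hPJ m).symm
  have hu𝔪 : ∀ i, u i ∈ maximalIdeal A' := fun i => hspan ▸ Ideal.subset_span ⟨i, rfl⟩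
  -- the model at `I' := weightedMonomialIdeal u w`
  obtain ⟨𝔫', h𝔫', Ψ, hSat, hV', hmax⟩ := hmodel (I' := weightedMonomialIdeal u w) hI'
  haveI := h𝔫'
  have hT' : cobordantT' u w ∈ 𝔫' := cobordantT'_mem_of_not_vertexIdeal_le u w hu𝔪 𝔫' hmax hV'
  have hP' : P.map (algebraMap A' (cobordantAlgebra' u w)) ≤ 𝔫' :=
    (Ideal.map_mono (IsLocalRing.le_maximalIdeal hP.ne_top)).trans hmax
  -- the factorisation `f₀ = (t⁻¹)ᵃ g₀`, `t⁻¹ ∤ g₀`, `σˢ((f₀)) = (g₀)`; the model carries `(gen)` onto `(g₀/1)`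
  obtain ⟨a, g₀, hfg, hndvd, hst⟩ := exists_factor_strictTransform_eq u w hspan hrk hf0
  have hΨ : (Ideal.span {gen}).map (Ψ : Sy →+* Localization.AtPrime 𝔫') =
      Ideal.span {algebraMap (cobordantAlgebra' u w) (Localization.AtPrime 𝔫') g₀} := by
    rw [hSat, hK₀, ← map_iSup_colon_pow_eq 𝔫' (Localization.AtPrime 𝔫'), ← strictTransform_eq_iSup_colon, hst,
      Ideal.map_span, Set.image_singleton]
  -- mutual divisibility of `gen` and `Ψ⁻¹(g₀/1)`
  have hd1 : gen ∣ Ψ.symm (algebraMap (cobordantAlgebra' u w) (Localization.AtPrime 𝔫') g₀) := by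
    have h1 : algebraMap (cobordantAlgebra' u w) (Localization.AtPrime 𝔫') g₀ ∈
        (Ideal.span {gen}).map (Ψ : Sy →+* Localization.AtPrime 𝔫') := by
      rw [hΨ]; exact Ideal.mem_span_singleton_self _
    rw [Ideal.map_span, Set.image_singleton, Ideal.mem_span_singleton, RingHom.coe_coe] at h1
    have h2 := map_dvd (Ψ.symm : Localization.AtPrime 𝔫' →+* Sy) h1
    simpa only [RingHom.coe_coe, RingEquiv.symm_apply_apply] using h2
  have hd2 : Ψ.symm (algebraMap (cobordantAlgebra' u w) (Localization.AtPrime 𝔫') g₀) ∣ gen := by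
    have h1 : Ψ gen ∈ Ideal.span {algebraMap (cobordantAlgebra' u w) (Localization.AtPrime 𝔫') g₀} := by
      rw [← hΨ]; exact Ideal.mem_map_of_mem _ (Ideal.mem_span_singleton_self gen)
    rw [Ideal.mem_span_singleton] at h1
    have h2 := map_dvd (Ψ.symm : Localization.AtPrime 𝔫' →+* Sy) h1
    simpa only [RingHom.coe_coe, RingEquiv.symm_apply_apply] using h2
  obtain ⟨hιeq, hsq⟩ := iota_eq_and_mem_sq_of_dvd_dvd' ι hc6 hu 𝔫' Ψ hgen2 _ hd1 hd2
  -- (drop)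
  rw [hιeq]
  exact hdrop 𝔫' hT' hP' hV' a g₀ hfg hndvd hsq

end ExcGameSide

/-! ## The exceptional half of [S6]: scheme level -/

section Exc

variable {p : ℕ} (ι : (R : Type) → [CommRing R] → R → Ordinal.{0})
  (J : (R : Type) → [CommRing R] → R → ℕ → Ideal R)

/-- **The position `(Γ(Y,U)_𝔮, F/1)` of a point of the maximum locus.**  For `Y → Spec k` smooth, `X(U) = (F)` on the affine
`U ∋ y`, `R` the canonical centre of `(Y, X)` and `R'` a Rees filtration with its pieces, and `y ∈ maxLocus ι X`: on the
model `A' = Γ(Y,U)_𝔮 ≅ 𝒪_{Y,y}` the local equation `F/1` is non-zero and in `𝔪²`, its `ι` is `iotaMax ι X`, the pieces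
`𝒥ₘ(U) · A'` are the canonical filtration `J(A', F/1)ₘ` and `X(U) · A' = (F/1)` (`…StalkDict`, `…PointDict`). [folklore] -/
theorem position_facts_of_mem_maxLocus (hc6 : IotaIsoInvariant ι) (hu : IotaUnitInvariant ι)
    (hJ : JIsoInvariant J) (hJu : JUnitInvariant J)
    {k : Type} [Field k] {Y : Scheme.{0}} (f : Y ⟶ Spec (.of k)) [Smooth f]
    (X : Y.IdealSheafData) (R : ReesAlgebraData Y) (hR : IsCanonicalCentre ι J X R)
    (R' : ReesFiltration Y) (hR' : R'.ideal = R.piece)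
    (U : Y.affineOpens) {y : Y} (hyU : y ∈ (U : Y.Opens)) (hyM : y ∈ maxLocus ι X)
    {F : Γ(Y, U)} (hF : X.ideal U = Ideal.span {F}) :
    algebraMap Γ(Y, U) (Localization.AtPrime (U.2.primeIdealOf ⟨y, hyU⟩).asIdeal) F ≠ 0 ∧
    algebraMap Γ(Y, U) (Localization.AtPrime (U.2.primeIdealOf ⟨y, hyU⟩).asIdeal) F ∈
      maximalIdeal (Localization.AtPrime (U.2.primeIdealOf ⟨y, hyU⟩).asIdeal) ^ 2 ∧
    ι (Localization.AtPrime (U.2.primeIdealOf ⟨y, hyU⟩).asIdeal)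
      (algebraMap Γ(Y, U) (Localization.AtPrime (U.2.primeIdealOf ⟨y, hyU⟩).asIdeal) F) = iotaMax ι X ∧
    (∀ m, ((R'.ideal m).ideal U).map (algebraMap Γ(Y, U) (Localization.AtPrime (U.2.primeIdealOf ⟨y, hyU⟩).asIdeal)) =
      J (Localization.AtPrime (U.2.primeIdealOf ⟨y, hyU⟩).asIdeal)
        (algebraMap Γ(Y, U) (Localization.AtPrime (U.2.primeIdealOf ⟨y, hyU⟩).asIdeal) F) m) ∧
    (X.ideal U).map (algebraMap Γ(Y, U) (Localization.AtPrime (U.2.primeIdealOf ⟨y, hyU⟩).asIdeal)) =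
      Ideal.span {algebraMap Γ(Y, U) (Localization.AtPrime (U.2.primeIdealOf ⟨y, hyU⟩).asIdeal) F} := by
  set 𝔮 := (U.2.primeIdealOf ⟨y, hyU⟩).asIdeal with h𝔮
  haveI : IsRegularLocalRing (Y.presheaf.stalk y) := isRegularLocalRing_stalk_of_smooth_of_field f y
  have hys : y ∈ singImage X := hyM.1
  have hf0 : algebraMap Γ(Y, U) (Localization.AtPrime 𝔮) F ≠ 0 := fun h =>
    germ_ne_zero_of_mem_singImage X U hyU hF hys ((algebraMap_eq_zero_iff_germ_eq_zero U hyU F).mp h)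
  refine ⟨hf0, (mem_singImage_iff_algebraMap_mem_sq X U hyU hF hf0).mp hys, ?_, fun m => ?_, ?_⟩
  · rw [← iotaAt_eq_iota_localization ι (hy := hyU) f hc6 hu X hF]
    exact hyM.2
  · have h1 : stalkIdeal (R.piece m) y = (((R.piece m).ideal U).map
        (algebraMap Γ(Y, U) (Localization.AtPrime 𝔮))).map (stalkEquiv U hyU : _ →+* Y.presheaf.stalk y) := by
      rw [map_stalkEquiv_map U hyU, stalkIdeal_eq_map_germ _ U hyU]
    have h2 : stalkIdeal (R.piece m) y = (J (Localization.AtPrime 𝔮)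
        (algebraMap Γ(Y, U) (Localization.AtPrime 𝔮) F) m).map (stalkEquiv U hyU : _ →+* Y.presheaf.stalk y) := by
      rw [hR.stalkIdeal_eq y hyM m, J_localGenerator_eq_map J (hy := hyU) f hJ hJu X hF m]
    have h3 := congrArg (Ideal.map ((stalkEquiv U hyU).symm : Y.presheaf.stalk y →+* Localization.AtPrime 𝔮))
      (h1.symm.trans h2)
    rw [Ideal.map_of_equiv, Ideal.map_of_equiv] at h3
    rw [← h3, hR']
  · rw [hF, Ideal.map_span, Set.image_singleton]

/-- The local equation of the successor at a point of its non-regular locus lies in `𝔪²` (`…PointDict`). [folklore] -/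
theorem localGenerator_mem_sq_of_mem_singImage {Y' : Scheme.{0}} (X' : Y'.IdealSheafData) (y' : Y')
    [IsRegularLocalRing (Y'.presheaf.stalk y')] (hX' : ∃ g : Y'.presheaf.stalk y', stalkIdeal X' y' = Ideal.span {g})
    (hy' : y' ∈ singImage X') : localGenerator X' y' ∈ maximalIdeal (Y'.presheaf.stalk y') ^ 2 :=
  have hg := stalkIdeal_eq_span_localGenerator X' y' hX'
  (mem_singImage_iff_mem_sq_of_stalkIdeal_eq X' hg (ne_zero_of_mem_singImage_of_stalkIdeal_eq X' hg hy')).mp hy'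

/-- **[S6], EXCEPTIONAL HALF.**  `ι` at a point `y'` of the non-regular locus of the successor lying over a point `y` of
the maximum locus of `(Y, X)` is strictly below `iotaMax ι X`, as soon as the stalk `𝒪_{Y',y'}` (regular, `X'_{y'}`
principal) is modelled by a local ring `(⊕ₙ 𝒥ₙ(U) tⁿ)_𝔫` of the chart of the global cobordant blow-up of the canonical
centre over a principal affine chart `(U, F)` of `X` at `y`, at a prime `𝔫` over the prime of `y` and off the irrelevant
ideal, the model carrying `X'_{y'}` onto the `t⁻¹`-saturation of `X(U)` (the holder's K4-E facts (I)(II)(III)) — by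
`iota_lt_of_plusStalk_model` at the position `(Γ(Y,U)_𝔮, F/1)`, whose `ι` is `iotaAt ι X y = iotaMax ι X`
(`…StalkDict`) and whose canonical filtration is presented by the pieces of `R` (`IsCanonicalCentre`).
[cite: Wlodarczyk2022, 3.3.12 and Def. 5.1.1] -/
theorem iotaAt_lt_iotaMax_of_mem_maxLocus_of_stalkIso (hc6 : IotaIsoInvariant ι) (hu : IotaUnitInvariant ι)
    (hJ : JIsoInvariant J) (hJu : JUnitInvariant J) (hgame : CanonicalGameClause p ι J)
    {k : Type} [Field k] [CharP k p] [PerfectField k] {Y : Scheme.{0}} (f : Y ⟶ Spec (.of k)) [Smooth f]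
    (X : Y.IdealSheafData) (R : ReesAlgebraData Y) (hR : IsCanonicalCentre ι J X R)
    (R' : ReesFiltration Y) (hR' : R'.ideal = R.piece)
    (U : Y.affineOpens) {y : Y} (hyU : y ∈ (U : Y.Opens)) (hyM : y ∈ maxLocus ι X)
    {F : Γ(Y, U)} (hF : X.ideal U = Ideal.span {F})
    {Y' : Scheme.{0}} (X' : Y'.IdealSheafData) (y' : Y') [IsRegularLocalRing (Y'.presheaf.stalk y')]
    (hX' : ∃ g : Y'.presheaf.stalk y', stalkIdeal X' y' = Ideal.span {g}) (hy' : y' ∈ singImage X')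
    (𝔫 : Ideal (R'.filtration U).extendedRees) [𝔫.IsPrime]
    (Ψ₁ : Y'.presheaf.stalk y' ≃+* Localization.AtPrime 𝔫)
    (hI : (stalkIdeal X' y').map (Ψ₁ : Y'.presheaf.stalk y' →+* Localization.AtPrime 𝔫) =
      ⨆ m : ℕ, (((X.ideal U).map (algebraMap Γ(Y, U) (R'.filtration U).extendedRees)).map
        (algebraMap (R'.filtration U).extendedRees (Localization.AtPrime 𝔫))).colon
        {algebraMap (R'.filtration U).extendedRees (Localization.AtPrime 𝔫)
          ⟨T (-1), (R'.filtration U).T_neg_one_mem_extendedRees⟩ ^ m})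
    (hII : 𝔫.comap (algebraMap Γ(Y, U) (R'.filtration U).extendedRees) = (U.2.primeIdealOf ⟨y, hyU⟩).asIdeal)
    (hIII : ¬ (R'.filtration U).irrelevant ≤ 𝔫) :
    iotaAt ι X' y' < iotaMax ι X := by
  -- the model `(A, 𝔮, F)` of `(𝒪_{Y,y}, f_y)`: of finite type over `k`, regular
  have hft : RingHom.FiniteType (f.appLE ⊤ U le_top).hom :=
    HasRingHomProperty.appLE @LocallyOfFiniteType f inferInstance ⟨⊤, isAffineOpen_top _⟩ U le_top
  let φ : k →+* Γ(Y, U) := (f.appLE ⊤ U le_top).hom.comp (Scheme.ΓSpecIso (.of k)).inv.hom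
  have hφ : φ.FiniteType :=
    hft.comp (RingHom.FiniteType.of_surjective _
      (Scheme.ΓSpecIso (.of k)).commRingCatIsoToRingEquiv.symm.surjective)
  letI : Algebra k Γ(Y, U) := φ.toAlgebra
  haveI : Algebra.FiniteType k Γ(Y, U) := hφ
  haveI : IsRegularLocalRing (Y.presheaf.stalk y) := isRegularLocalRing_stalk_of_smooth_of_field f y
  haveI : IsRegularLocalRing (Localization.AtPrime (U.2.primeIdealOf ⟨y, hyU⟩).asIdeal) :=
    IsRegularLocalRing.of_ringEquiv (stalkEquiv U hyU).symm
  obtain ⟨hf0, hf2, hιy, hFJ, hK₀⟩ := position_facts_of_mem_maxLocus ι J hc6 hu hJ hJu f X R hR R' hR' U hyU hyM hF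
  have hg := stalkIdeal_eq_span_localGenerator X' y' hX'
  rw [hg] at hI
  have hlt := iota_lt_of_plusStalk_model ι J hc6 hu hgame k (U.2.primeIdealOf ⟨y, hyU⟩).asIdeal hf0 hf2
    (R'.filtration U) hFJ (X.ideal U) hK₀ 𝔫 hII hIII Ψ₁ (localGenerator_mem_sq_of_mem_singImage X' y' hX' hy') hI
  rw [hιy] at hlt
  exact hlt


/-- **[S6], EXCEPTIONAL HALF — from res-type-089's game-side stalk model (export (A)).**  Same conclusion as
`iotaAt_lt_iotaMax_of_mem_maxLocus_of_stalkIso`, the successor's stalk `𝒪_{Y',y'}` being modelled directly by local rings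
of the game-side carriers `Γ(Y,U)_𝔮[t⁻¹, I'ₙ tⁿ]` for every sequence `I'` extended from the pieces of `R'` (a prime off the
vertex containing `𝔪`, the model carrying `X'_{y'}` onto the `t⁻¹`-saturation of `X(U)`), by `iota_lt_of_gameSide_model`.
[cite: Wlodarczyk2022, 3.3.12 and Def. 5.1.1] -/
theorem iotaAt_lt_iotaMax_of_mem_maxLocus_of_gameSideModel (hc6 : IotaIsoInvariant ι) (hu : IotaUnitInvariant ι)
    (hJ : JIsoInvariant J) (hJu : JUnitInvariant J) (hgame : CanonicalGameClause p ι J)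
    {k : Type} [Field k] [CharP k p] [PerfectField k] {Y : Scheme.{0}} (f : Y ⟶ Spec (.of k)) [Smooth f]
    (X : Y.IdealSheafData) (R : ReesAlgebraData Y) (hR : IsCanonicalCentre ι J X R)
    (R' : ReesFiltration Y) (hR' : R'.ideal = R.piece)
    (U : Y.affineOpens) {y : Y} (hyU : y ∈ (U : Y.Opens)) (hyM : y ∈ maxLocus ι X)
    {F : Γ(Y, U)} (hF : X.ideal U = Ideal.span {F})
    {Y' : Scheme.{0}} (X' : Y'.IdealSheafData) (y' : Y') [IsRegularLocalRing (Y'.presheaf.stalk y')]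
    (hX' : ∃ g : Y'.presheaf.stalk y', stalkIdeal X' y' = Ideal.span {g}) (hy' : y' ∈ singImage X')
    (hmodel : ∀ {I' : ℕ → Ideal (Localization.AtPrime (U.2.primeIdealOf ⟨y, hyU⟩).asIdeal)},
      (∀ n, I' n = ((R'.ideal n).ideal U).map
        (algebraMap Γ(Y, U) (Localization.AtPrime (U.2.primeIdealOf ⟨y, hyU⟩).asIdeal))) →
      ∃ (𝔫' : Ideal (extReesAlgebra I')) (_ : 𝔫'.IsPrime)
        (Ψ : Y'.presheaf.stalk y' ≃+* Localization.AtPrime 𝔫'),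
        (stalkIdeal X' y').map (Ψ : Y'.presheaf.stalk y' →+* Localization.AtPrime 𝔫') =
          ⨆ n : ℕ, ((((X.ideal U).map (algebraMap Γ(Y, U)
            (Localization.AtPrime (U.2.primeIdealOf ⟨y, hyU⟩).asIdeal))).map
            (algebraMap (Localization.AtPrime (U.2.primeIdealOf ⟨y, hyU⟩).asIdeal) (extReesAlgebra I'))).map
            (algebraMap (extReesAlgebra I') (Localization.AtPrime 𝔫'))).colon
            {algebraMap (extReesAlgebra I') (Localization.AtPrime 𝔫') (extReesAlgebra.tInv I') ^ n} ∧
        ¬ extReesAlgebra.vertexIdeal I' ≤ 𝔫' ∧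
        (maximalIdeal (Localization.AtPrime (U.2.primeIdealOf ⟨y, hyU⟩).asIdeal)).map
          (algebraMap (Localization.AtPrime (U.2.primeIdealOf ⟨y, hyU⟩).asIdeal) (extReesAlgebra I')) ≤ 𝔫') :
    iotaAt ι X' y' < iotaMax ι X := by
  -- the model `(A, 𝔮, F)` of `(𝒪_{Y,y}, f_y)`: of finite type over `k`, regular
  have hft : RingHom.FiniteType (f.appLE ⊤ U le_top).hom :=
    HasRingHomProperty.appLE @LocallyOfFiniteType f inferInstance ⟨⊤, isAffineOpen_top _⟩ U le_top
  let φ : k →+* Γ(Y, U) := (f.appLE ⊤ U le_top).hom.comp (Scheme.ΓSpecIso (.of k)).inv.hom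
  have hφ : φ.FiniteType :=
    hft.comp (RingHom.FiniteType.of_surjective _
      (Scheme.ΓSpecIso (.of k)).commRingCatIsoToRingEquiv.symm.surjective)
  letI : Algebra k Γ(Y, U) := φ.toAlgebra
  haveI : Algebra.FiniteType k Γ(Y, U) := hφ
  haveI : IsRegularLocalRing (Y.presheaf.stalk y) := isRegularLocalRing_stalk_of_smooth_of_field f y
  haveI : IsRegularLocalRing (Localization.AtPrime (U.2.primeIdealOf ⟨y, hyU⟩).asIdeal) :=
    IsRegularLocalRing.of_ringEquiv (stalkEquiv U hyU).symm
  obtain ⟨hf0, hf2, hιy, hPJ, hK₀⟩ := position_facts_of_mem_maxLocus ι J hc6 hu hJ hJu f X R hR R' hR' U hyU hyM hF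
  have hlt := iota_lt_of_gameSide_model ι J hc6 hu hgame k hf0 hf2 (fun m => (R'.ideal m).ideal U) hPJ (X.ideal U)
    hK₀ (localGenerator_mem_sq_of_mem_singImage X' y' hX' hy') (stalkIdeal X' y')
    (stalkIdeal_eq_span_localGenerator X' y' hX') hmodel
  rw [hιy] at hlt
  exact hlt

end Exc

end Summit.ResolutionOfSingularities.ResolutionOfSingularities.Cruxes.HypersurfaceCentreConstruction.LocalEngine

end
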